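import Summits.CriticalPhenomena.PercolationContinuityZ3.Theorems.PercNearOneGluingAdditiveGluingBystanderBHK
import Literature.Probability.Percolation.TwoClusterConditionalAssociation
import HarnessLib

/-!
# Kozma–Nitzan's Lemma 3 for bystander events

Crux `PercNearOneGluing.AdditiveGluing` (stmt-CriticalPhenomena-4576), line `subuniform-dead-pocket-maximum`,
kernel `C1` (|A∖b| = 2) of `stub_goodStep` (siege k42); file 3/4.

* `bystander_negCorr` — the bystander-BHK inequality (`BystanderBHK.core`, file 2) transported to
  `prodBernoulli w`: for an increasing event `A` determined by the open edge cluster of `s`, a vertex set `X`,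
  `D = {s ↮ X}` and the bystander event `E = {C(o) ∩ X ≠ ∅} ∪ {C(o) ∈ 𝓡}` of an ARBITRARY family `𝓡` of vertex
  sets not containing `s`:  `μ(A ∩ E ∩ D) · μ(D) ≤ μ(A ∩ D) · μ(E ∩ D)` (negative correlation given `D`).
* `bystander_lemma3` (registered as `stub_bystanderLemma3_k42`) — **Kozma–Nitzan arXiv:2401.12397 Lemma 3 for
  the non-monotone events `E = {o ↔ a₂} ∪ {C(o) ∈ 𝓡}`** (`𝓡` any family of sets avoiding `a₁`): if
  `μ(a₁ ↔ b) ≤ μ(a₂ ↔ b)` then `μ(a₁ ↔ b, E, a₁ ↮ a₂) ≤ μ(a₂ ↔ b, E, a₁ ↮ a₂)`.  `𝓡 = ∅` is Lemma 3(i) with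
  `Q = {o ↔ a₂}`, `𝓡` = everything is Lemma 3(ii) with `Q = {o ↮ a₁}`; the interpolation is what the two-relay
  kernel of goodness needs (file 4), where `𝓡` = the RE-ORDERING dead pockets, a family with no monotonicity.
  Proof: `bystander_negCorr` at `s = a₁` and at `s = a₂` (complementary family `{W | a₂ ∉ W, W ∉ 𝓡}`, whose
  bystander event is `D ∖ E`) sandwich `P(E | a₁↔b, D) ≤ P(E | D) ≤ P(E | a₂↔b, D)`.
-/

noncomputable section

namespace Summit.CriticalPhenomena.PercolationContinuityZ3.Theorems

open Literature.Probability.Percolation Literature.Probability.Percolation.BHK2006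
open DecisionTree (ind ind_of_mem ind_of_not_mem ind_nonneg)
open scoped Classical

/-! ### From product weights to `prodBernoulli`: the bystander inequality for events -/

section Measure

open MeasureTheory
open Literature.Probability.LatticeModels (prodBernoulli)

variable {V : Type*} [Fintype V]

/-- `μ(S)` as a finite weighted sum of the indicator of `S`. [folklore] -/
theorem real_eq_sum_ind (w : Sym2 V → unitInterval) (S : Set (BondConfig V)) :
    (prodBernoulli w).real S = ∑ ω, weight (fun e => (w e : ℝ)) ω * ind S ω := by
  rw [← integral_indicator_one MeasurableSet.of_discrete, integral_prodBernoulli_eq_sum]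
  refine Finset.sum_congr rfl fun ω _ => ?_
  by_cases hω : ω ∈ S
  · rw [Set.indicator_of_mem hω, ind_of_mem hω, Pi.one_apply]
  · rw [Set.indicator_of_notMem hω, ind_of_not_mem hω, mul_zero]

/-- **The bystander inequality for events.** Let `A` be an increasing event determined by the open edge
cluster of `s`, `X` a vertex set, `D = {s ↮ X}`, and `E = {C(o) ∩ X ≠ ∅} ∪ {C(o) ∈ 𝓡}` the bystander
event of an arbitrary family `𝓡` of vertex sets not containing `s`.  Then
`μ(A ∩ E ∩ D) · μ(D) ≤ μ(A ∩ D) · μ(E ∩ D)`: given `{s ↮ X}`, the increasing cluster event `A` is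
NEGATIVELY correlated with the (non-monotone) bystander event. [folklore] -/
theorem bystander_negCorr (w : Sym2 V → unitInterval) (s o : V) (X : Set V) (𝓡 : Set (Set V))
    (h𝓡 : ∀ W ∈ 𝓡, s ∉ W) (A : Set (BondConfig V))
    (hA : ∀ ω ω', ω ∈ A → openEdgeCluster ω s ⊆ openEdgeCluster ω' s → ω' ∈ A) :
    (prodBernoulli w).real (A ∩ {ω | (∃ t ∈ X, t ∈ openCluster ω o) ∨ openCluster ω o ∈ 𝓡} ∩
        {ω | ∀ x ∈ X, ¬ (openGraph ω).Reachable s x}) *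
      (prodBernoulli w).real {ω | ∀ x ∈ X, ¬ (openGraph ω).Reachable s x} ≤
    (prodBernoulli w).real (A ∩ {ω | ∀ x ∈ X, ¬ (openGraph ω).Reachable s x}) *
      (prodBernoulli w).real ({ω | (∃ t ∈ X, t ∈ openCluster ω o) ∨ openCluster ω o ∈ 𝓡} ∩
        {ω | ∀ x ∈ X, ¬ (openGraph ω).Reachable s x}) := by
  set D : Set (BondConfig V) := {ω | ∀ x ∈ X, ¬ (openGraph ω).Reachable s x} with hD
  set E : Set (BondConfig V) := {ω | (∃ t ∈ X, t ∈ openCluster ω o) ∨ openCluster ω o ∈ 𝓡} with hE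
  set w' : Sym2 V → ℝ := fun e => (w e : ℝ) with hw'
  have hw0 : ∀ e, 0 ≤ w' e := fun e => (w e).2.1
  have hw1 : ∀ e, w' e ≤ 1 := fun e => (w e).2.2
  have hm : ∑ ω, weight w' ω = 1 := by
    have h1 := integral_prodBernoulli_eq_sum w fun _ => (1 : ℝ)
    simp only [integral_const, probReal_univ, smul_eq_mul, mul_one] at h1
    exact h1.symm
  -- `U = univ`: the restricted quantities are the original ones
  have hU : ∀ ω : Set (Sym2 V), ω ∩ edgesIn (Finset.univ : Finset V) = ω := fun ω => by
    ext e
    simp only [Set.mem_inter_iff, edgesIn, Set.mem_setOf_eq, Finset.mem_univ, imp_true_iff,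
      and_true]
  have hC : ∀ ω, rC Finset.univ s ω = openEdgeCluster ω s := fun ω => by simp only [rC, hU]
  have hDD : rD Finset.univ s X = D := by
    ext ω; simp only [rD, hU, hD, Set.mem_setOf_eq]
  have hEE : {η : Set (Sym2 V) | (∃ t ∈ X, t ∈ openCluster (η ∩ edgesIn Finset.univ) o) ∨
      openCluster (η ∩ edgesIn Finset.univ) o ∈ 𝓡} = E := by
    ext ω; simp only [hU, hE, Set.mem_setOf_eq]
  -- the increasing function of `C_s` representing `A`
  set F : Set (Sym2 V) → ℝ := ind {C | ∃ ω' ∈ A, openEdgeCluster ω' s ⊆ C} with hF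
  have hFm : Monotone F := fun C C' hCC' => by
    by_cases hC : C ∈ {C | ∃ ω' ∈ A, openEdgeCluster ω' s ⊆ C}
    · obtain ⟨ω', hω', hsub⟩ := hC
      have hC' : C' ∈ {C | ∃ ω' ∈ A, openEdgeCluster ω' s ⊆ C} := ⟨ω', hω', hsub.trans hCC'⟩
      simp only [hF]
      rw [ind_of_mem (show C ∈ {C | ∃ ω' ∈ A, openEdgeCluster ω' s ⊆ C} from ⟨ω', hω', hsub⟩),
        ind_of_mem hC']
    · simp only [hF]
      rw [ind_of_not_mem hC]
      exact ind_nonneg _ _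
  have hF0 : ∀ a, 0 ≤ F a := fun a => ind_nonneg _ _
  have hFA : ∀ ω, F (openEdgeCluster ω s) = ind A ω := fun ω => by
    refine BystanderBHK.ind_congr ⟨?_, fun hω => ⟨ω, hω, subset_rfl⟩⟩
    rintro ⟨ω', hω', hsub⟩
    exact hA ω' ω hω' hsub
  have hXU : X ⊆ ↑(Finset.univ : Finset V) := by simp
  have key := BystanderBHK.core w' hw0 hw1 hm o 𝓡 Finset.univ s (Finset.mem_univ s) h𝓡 X X hXU hXU
    F hFm hF0
  rw [Set.inter_self, Set.union_self] at key
  simp only [hC, hDD, hEE, hFA] at key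
  -- identify the four sums with measures
  rw [real_eq_sum_ind w (A ∩ E ∩ D), real_eq_sum_ind w D, real_eq_sum_ind w (A ∩ D),
    real_eq_sum_ind w (E ∩ D)]
  simp only [ind_inter]
  simpa only [mul_assoc] using key

end Measure

/-! ### Kozma–Nitzan's Lemma 3 for bystander events -/

section Lemma3

open MeasureTheory
open Literature.Probability.LatticeModels (prodBernoulli)

variable {V : Type*} [Fintype V]

omit [Fintype V] in
/-- `{a₁ ↮ a₂}` written as BHK's `R_{{a₂}}`. [folklore] -/
theorem setOf_not_reachable_singleton (a₁ a₂ : V) :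
    {ω : BondConfig V | ∀ x ∈ ({a₂} : Set V), ¬ (openGraph ω).Reachable a₁ x} = (openConn a₁ a₂)ᶜ := by
  ext ω
  simp only [Set.mem_setOf_eq, Set.mem_singleton_iff, forall_eq, Set.mem_compl_iff]
  rfl

omit [Fintype V] in
/-- The bystander event with `X = {a₂}` is `{o ↔ a₂} ∪ {C(o) ∈ 𝓡}`. [folklore] -/
theorem setOf_bystander_singleton (o a₂ : V) (𝓡 : Set (Set V)) :
    {ω : BondConfig V | (∃ t ∈ ({a₂} : Set V), t ∈ openCluster ω o) ∨ openCluster ω o ∈ 𝓡} =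
      openConn o a₂ ∪ {ω | openCluster ω o ∈ 𝓡} := by
  ext ω
  simp only [Set.mem_setOf_eq, Set.mem_singleton_iff, exists_eq_left, Set.mem_union]
  rfl

omit [Fintype V] in
/-- `{x ↔ b}` is increasing and determined by the open edge cluster of `x`. [folklore] -/
theorem openConn_determinedBy_openEdgeCluster (x b : V) (ω ω' : BondConfig V)
    (hω : ω ∈ openConn x b) (h : openEdgeCluster ω x ⊆ openEdgeCluster ω' x) : ω' ∈ openConn x b := by
  have h1 : connIndicatorFn x b (openEdgeCluster ω x) ≤ connIndicatorFn x b (openEdgeCluster ω' x) :=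
    monotone_connIndicatorFn x b h
  rw [connIndicatorFn_openEdgeCluster, connIndicatorFn_openEdgeCluster,
    Set.indicator_of_mem hω, Pi.one_apply] at h1
  by_contra hω'
  rw [Set.indicator_of_notMem hω'] at h1
  exact absurd h1 (by norm_num)

/-- Off `{a₁ ↮ a₂}` the events `{a₁ ↔ b}` and `{a₂ ↔ b}` agree, so
`μ(a₁ ↔ b) ≤ μ(a₂ ↔ b)` transfers to `μ(a₁ ↔ b, a₁ ↮ a₂) ≤ μ(a₂ ↔ b, a₁ ↮ a₂)`.
[cite: KozmaNitzan2024, Lemma 3 (proof, first display)] -/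
theorem real_openConn_inter_compl_le (w : Sym2 V → unitInterval) (a₁ a₂ b : V)
    (hle : (prodBernoulli w).real (openConn a₁ b) ≤ (prodBernoulli w).real (openConn a₂ b)) :
    (prodBernoulli w).real (openConn a₁ b ∩ (openConn a₁ a₂)ᶜ) ≤
      (prodBernoulli w).real (openConn a₂ b ∩ (openConn a₁ a₂)ᶜ) := by
  have hDm : MeasurableSet ((openConn a₁ a₂)ᶜ : Set (BondConfig V)) := MeasurableSet.of_discrete
  have hagree : (openConn a₁ b : Set (BondConfig V)) \ (openConn a₁ a₂)ᶜ =
      openConn a₂ b \ (openConn a₁ a₂)ᶜ := by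
    ext ω
    simp only [Set.mem_sdiff, Set.mem_compl_iff, not_not]
    constructor
    · rintro ⟨h1, h2⟩
      exact ⟨SimpleGraph.Reachable.trans (SimpleGraph.Reachable.symm h2) h1, h2⟩
    · rintro ⟨h1, h2⟩
      exact ⟨SimpleGraph.Reachable.trans h2 h1, h2⟩
  have hs1 := measureReal_inter_add_sdiff (μ := prodBernoulli w) (s := openConn a₁ b) hDm
  have hs2 := measureReal_inter_add_sdiff (μ := prodBernoulli w) (s := openConn a₂ b) hDm
  rw [hagree] at hs1
  linarith

/-- **Kozma–Nitzan's Lemma 3 for bystander events.** Let `o, a₁, a₂, b` be vertices with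
`μ(a₁ ↔ b) ≤ μ(a₂ ↔ b)`, and let `E = {o ↔ a₂} ∪ {C(o) ∈ 𝓡}` for an ARBITRARY family `𝓡` of vertex sets
not containing `a₁`.  Then `μ(a₁ ↔ b, E, a₁ ↮ a₂) ≤ μ(a₂ ↔ b, E, a₁ ↮ a₂)`.
(`𝓡 = ∅`: Kozma–Nitzan arXiv:2401.12397 Lemma 3(i) with `Q = {o ↔ a₂}`; `𝓡` = all sets avoiding `a₁`:
Lemma 3(ii) with `Q = {o ↮ a₁}`; the general case — a non-monotone event — is new.)
Proof: the bystander inequality for `s = a₁` and for `s = a₂` (with the complementary family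
`{W | a₂ ∉ W, W ∉ 𝓡}`) sandwich `P(E | ·)`: `P(E | L₁) ≤ P(E | D) ≤ P(E | L₂)` for
`L₁ = {a₁↔b, a₁↮a₂}`, `D = {a₁↮a₂}`, `L₂ = {a₂↔b, a₁↮a₂}`, and `μ(L₁) ≤ μ(L₂)` by the hypothesis. [folklore] -/
theorem bystander_lemma3 (w : Sym2 V → unitInterval) (o a₁ a₂ b : V) (𝓡 : Set (Set V))
    (h𝓡 : ∀ W ∈ 𝓡, a₁ ∉ W)
    (hle : (prodBernoulli w).real (openConn a₁ b) ≤ (prodBernoulli w).real (openConn a₂ b)) :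
    (prodBernoulli w).real (openConn a₁ b ∩ (openConn o a₂ ∪ {ω | openCluster ω o ∈ 𝓡}) ∩
        (openConn a₁ a₂)ᶜ) ≤
      (prodBernoulli w).real (openConn a₂ b ∩ (openConn o a₂ ∪ {ω | openCluster ω o ∈ 𝓡}) ∩
        (openConn a₁ a₂)ᶜ) := by
  set μ := prodBernoulli w with hμ
  set D : Set (BondConfig V) := (openConn a₁ a₂)ᶜ with hD
  set E : Set (BondConfig V) := openConn o a₂ ∪ {ω | openCluster ω o ∈ 𝓡} with hE
  have hEm : MeasurableSet E := MeasurableSet.of_discrete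
  -- (H1): the bystander inequality for `s = a₁`, `X = {a₂}`, `A = {a₁ ↔ b}`
  have H1 : μ.real (openConn a₁ b ∩ E ∩ D) * μ.real D ≤
      μ.real (openConn a₁ b ∩ D) * μ.real (E ∩ D) := by
    have h := bystander_negCorr w a₁ o ({a₂} : Set V) 𝓡 h𝓡 (openConn a₁ b)
      (openConn_determinedBy_openEdgeCluster a₁ b)
    rwa [setOf_not_reachable_singleton, setOf_bystander_singleton] at h
  -- (H2): the bystander inequality for `s = a₂`, `X = {a₁}`, `A = {a₂ ↔ b}`, complementary family
  have H2 : μ.real (openConn a₂ b ∩ D) * μ.real (E ∩ D) ≤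
      μ.real (openConn a₂ b ∩ E ∩ D) * μ.real D := by
    have h := bystander_negCorr w a₂ o ({a₁} : Set V) {W | a₂ ∉ W ∧ W ∉ 𝓡}
      (fun W hW => hW.1) (openConn a₂ b) (openConn_determinedBy_openEdgeCluster a₂ b)
    rw [setOf_not_reachable_singleton, setOf_bystander_singleton] at h
    have hD' : (openConn a₂ a₁ : Set (BondConfig V))ᶜ = D := by
      rw [hD]
      congr 1
      ext ω
      exact ⟨fun h => SimpleGraph.Reachable.symm h, fun h => SimpleGraph.Reachable.symm h⟩
    -- the complementary bystander event is the complement of `E` inside `D`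
    have hE' : (openConn o a₁ ∪ {ω | openCluster ω o ∈ {W | a₂ ∉ W ∧ W ∉ 𝓡}}) ∩ D = D \ E := by
      ext ω
      simp only [Set.mem_inter_iff, Set.mem_union, Set.mem_setOf_eq, Set.mem_sdiff, hE, hD,
        Set.mem_compl_iff]
      constructor
      · rintro ⟨h | ⟨ha₂, hR⟩, hDω⟩
        · refine ⟨hDω, ?_⟩
          rintro (h2 | hR)
          · exact hDω ((SimpleGraph.Reachable.symm h).trans h2)
          · exact h𝓡 _ hR h
        · refine ⟨hDω, ?_⟩
          rintro (h2 | hR')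
          · exact ha₂ h2
          · exact hR hR'
      · rintro ⟨hDω, hnot⟩
        refine ⟨Or.inr ⟨fun h2 => hnot (Or.inl h2), fun hR => hnot (Or.inr hR)⟩, hDω⟩
    rw [hD', Set.inter_assoc, hE'] at h
    -- `μ((A' ∩ D) ∖ E) = μ(A' ∩ D) − μ(A' ∩ D ∩ E)` and `μ(D ∖ E) = μ(D) − μ(D ∩ E)`
    have hsplit1 := measureReal_inter_add_sdiff (μ := μ) (s := openConn a₂ b ∩ D) hEm
    have hsplit2 := measureReal_inter_add_sdiff (μ := μ) (s := D) hEm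
    have h3 : (openConn a₂ b : Set (BondConfig V)) ∩ (D \ E) = (openConn a₂ b ∩ D) \ E := by
      rw [Set.inter_sdiff_assoc]
    have h4 : (openConn a₂ b : Set (BondConfig V)) ∩ D ∩ E = openConn a₂ b ∩ E ∩ D :=
      Set.inter_right_comm _ _ _
    have h5 : D ∩ E = E ∩ D := Set.inter_comm _ _
    rw [h3, ← hμ] at h
    rw [h4] at hsplit1
    rw [h5] at hsplit2
    have hp : μ.real ((openConn a₂ b ∩ D) \ E) =
        μ.real (openConn a₂ b ∩ D) - μ.real (openConn a₂ b ∩ E ∩ D) := by linarith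
    have hq : μ.real (D \ E) = μ.real D - μ.real (E ∩ D) := by linarith
    rw [hp, hq] at h
    nlinarith [h]
  -- `μ(L₁) ≤ μ(L₂)`
  have hx : μ.real (openConn a₁ b ∩ D) ≤ μ.real (openConn a₂ b ∩ D) :=
    real_openConn_inter_compl_le w a₁ a₂ b hle
  -- combine
  have hd0 : 0 ≤ μ.real D := measureReal_nonneg
  have he0 : 0 ≤ μ.real (E ∩ D) := measureReal_nonneg
  rcases eq_or_lt_of_le hd0 with hd | hd
  · have : μ.real (openConn a₁ b ∩ E ∩ D) = 0 :=
      measureReal_mono_null Set.inter_subset_right hd.symm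
    rw [this]
    exact measureReal_nonneg
  · refine le_of_mul_le_mul_right ?_ hd
    calc μ.real (openConn a₁ b ∩ E ∩ D) * μ.real D
        ≤ μ.real (openConn a₁ b ∩ D) * μ.real (E ∩ D) := H1
      _ ≤ μ.real (openConn a₂ b ∩ D) * μ.real (E ∩ D) := mul_le_mul_of_nonneg_right hx he0
      _ ≤ μ.real (openConn a₂ b ∩ E ∩ D) * μ.real D := H2

end Lemma3

section Stub3

open Literature.Probability.LatticeModels (prodBernoulli)

/-- **Registered sub-goal `stub_bystanderLemma3_k42`** (siege k42): Kozma–Nitzan's Lemma 3 for bystander events,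
closed form of `bystander_lemma3` (vertex type in `Type`). [folklore] -/
theorem stub_bystanderLemma3_k42 : ∀ (V : Type) [Fintype V] (w : Sym2 V → unitInterval) (o a₁ a₂ b : V) (𝓡 : Set (Set V)), (∀ W ∈ 𝓡, a₁ ∉ W) → (prodBernoulli w).real (openConn a₁ b) ≤ (prodBernoulli w).real (openConn a₂ b) → (prodBernoulli w).real (openConn a₁ b ∩ (openConn o a₂ ∪ {ω | openCluster ω o ∈ 𝓡}) ∩ (openConn a₁ a₂)ᶜ) ≤ (prodBernoulli w).real (openConn a₂ b ∩ (openConn o a₂ ∪ {ω | openCluster ω o ∈ 𝓡}) ∩ (openConn a₁ a₂)ᶜ) :=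
  fun _ _ w o a₁ a₂ b 𝓡 h𝓡 hle => bystander_lemma3 w o a₁ a₂ b 𝓡 h𝓡 hle

end Stub3

end Summit.CriticalPhenomena.PercolationContinuityZ3.Theorems
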